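import Literature.Computability.Complexity.SpaceTMSAT
import Literature.Computability.Complexity.SpaceOracles
import HarnessLib

/-!
# The bounded-halting language `SPACETMSAT`, II: `PSPACE`-hardness, completeness, and `F1`

Sequel of `SpaceTMSAT.lean` (the language `SPACETMSAT` of instances `⟨P, ⟨cfg, ⟨u, ⟨k, acc⟩⟩⟩⟩`
accepted by the guarded universal simulation, and its `PSPACE` decider). Here we prove the other
half of Arora–Barak 2009, §4.2 (eq. (4.3) `SPACE TMSAT`, Exercise 4.2; Homer–Selman 2011, §7.5.1,
`𝒰_PS`, Homework 7.13): **every `L ∈ PSPACE` Karp-reduces to `SPACETMSAT`**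
(`isHard_PSPACE_SPACETMSAT`), hence `SPACETMSAT` is `PSPACE`-complete
(`isComplete_PSPACE_SPACETMSAT`) and the named fact `exists_isComplete_PSPACE` of
`SpaceOracles.lean` is discharged (`exists_isComplete_PSPACE_holds`).

**The reduction** (textbook: `x ↦ ⟨M, x, 1^{s(|x|)}⟩`). A language of `PSPACE` comes with an
input-preserving space machine `M` deciding it in work space `c·nʲ + c` (`Space.lean`). Compile
its `FinTM2` to a standard machine (`TM2Std.stdCode`, `PolyTimeCountable.lean`), that to a flat
program `P` (`FlatProg.compile`, `FlatPrograms.lean`), and map `x` to the instance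
`⟨P, ⟨cfg₀(x), ⟨1^{B(|x|)}, ⟨k₁, acc⟩⟩⟩⟩` where `cfg₀(x)` codes the initial configuration of `M` on
`x` (all stacks empty but the input stack), `B` is a linear function of the space bound (the code
of a configuration is linear in its number of stack symbols), `k₁` is the output stack and `acc`
the code of the output stack holding the symbol `true`. The map is in `FP`: besides constants it
consists of one finite-state transduction (the coded input stack) placed by `setNthLF` and one
unary polynomial (`Plumb.polyFn`).

**Correctness.** Along the genuine computation the guard never fires: the stack symbols of the
machine configurations number `≤ |x| + space` (input preservation + the space bound), the flat
program adds at most `haltAddr` symbols inside one simulated machine step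
(`FlatProg.runsB_step`, `stkTotal_iterate_le`), symbols stay `≤ N` and the program counter
`≤ haltAddr`, so every code met has length `≤ B(|x|)`; hence the orbit is the universal
simulation (`UnivStep.iterate_ustepFn_enc_trCfg`, `SpaceTMSAT.mem_SPACETMSAT_iff`). The machine
halts; its flat program reaches the fixed code of the halting configuration
(`FlatProg.exists_iterate_eq_of_mem_eval`), and it does so within `(B+1)·2^B ≤ 2^{2B+1}` steps
because the codes met before are pairwise distinct (a repetition would make the run periodic and
never halting) and all of length `≤ B` — the pigeonhole of Arora–Barak's Thm. 4.2 / Rem. 4.3.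
Finally the answer bit reads the output stack, whose single symbol is `true` iff `x ∈ L`.

## References

* S. Arora, B. Barak, *Computational Complexity: A Modern Approach*, CUP 2009, §4.2 (Def. 4.9,
  eq. (4.3), Exercise 4.2), Thm. 4.2, Rem. 4.3 [AroraBarakCC2009].
* S. Homer, A. L. Selman, *Computability and Complexity Theory*, 2nd ed., 2011, §7.5.1
  (Prop. 7.7, Homework 7.13), Thm. 7.17 [HomerSelman2011].
-/

noncomputable section

namespace Literature.Computability.Complexity

open _root_.Computability Polynomial Brick Turing Function

namespace SpaceTMSAT

open UnivStep FlatProg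

/-! ### Periodic orbits never reach an absorbing property later -/

/-- If an orbit of `f` revisits a point, `f^[i] a = f^[j] a` with `i < j`, then it is periodic from
`i` on. [folklore] -/
theorem iterate_add_mul_eq {α : Type} (f : α → α) (a : α) {i j : ℕ} (h : f^[i] a = f^[j] a)
    (hij : i ≤ j) (q : ℕ) : f^[i + q * (j - i)] a = f^[i] a := by
  induction q with
  | zero => simp
  | succ q ih =>
    rw [Nat.succ_mul, ← Nat.add_assoc, Nat.add_comm (i + q * (j - i)) (j - i), iterate_add_apply, ih,
      ← iterate_add_apply, Nat.sub_add_cancel hij, h]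

/-- **No repetition before an absorbing event.** If a property `p`, once true along the orbit,
stays true, and holds at some time, then the points of the orbit before the FIRST time it holds
are pairwise distinct. [cite: AroraBarakCC2009, Thm. 4.2 (proof: a halting space-bounded computation never repeats a configuration)] -/
theorem iterate_ne_of_lt_find {α : Type} (f : α → α) (a : α) (p : α → Prop) [DecidablePred p]
    (hex : ∃ n, p (f^[n] a)) (habs : ∀ n, p (f^[n] a) → p (f^[n + 1] a)) {i j : ℕ} (hij : i < j)
    (hj : j ≤ Nat.find hex) : f^[i] a ≠ f^[j] a := by
  intro h
  have hmono : ∀ n d, p (f^[n] a) → p (f^[n + d] a) := by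
    intro n d hn
    induction d with
    | zero => exact hn
    | succ d ih => exact habs _ ih
  have hi : ¬ p (f^[i] a) := Nat.find_min hex (lt_of_lt_of_le hij hj)
  have key := iterate_add_mul_eq f a h hij.le (Nat.find hex)
  have hle : Nat.find hex ≤ i + Nat.find hex * (j - i) :=
    (Nat.le_mul_of_pos_right _ (Nat.sub_pos_of_lt hij)).trans (Nat.le_add_left _ _)
  obtain ⟨d, hd⟩ := Nat.exists_eq_add_of_le hle
  have := hmono _ d (Nat.find_spec hex)
  rw [← hd, key] at this
  exact hi this

/-! ### Counting short strings -/

/-- **Fewer than `(B+1)·2^B` pairwise distinct strings of length `≤ B`**: an injective family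
`g : Fin n → {0,1}^{≤ B}` has `n ≤ (B + 1) · 2 ^ B`. [folklore] -/
theorem card_le_of_injective_short {n B : ℕ} (g : ℕ → List Bool) (hlen : ∀ m < n, (g m).length ≤ B)
    (hinj : ∀ m₁ < n, ∀ m₂ < n, g m₁ = g m₂ → m₁ = m₂) : n ≤ (B + 1) * 2 ^ B := by
  classical
  let φ : ℕ → ℕ × (Fin B → Bool) := fun m => ((g m).length, fun i => (g m).getD i.val false)
  have hmaps : ∀ m ∈ Finset.range n, φ m ∈ (Finset.range (B + 1)) ×ˢ (Finset.univ : Finset (Fin B → Bool)) := by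
    intro m hm
    rw [Finset.mem_range] at hm
    simp only [Finset.mem_product, Finset.mem_range, Finset.mem_univ, and_true, φ]
    exact Nat.lt_succ_of_le (hlen m hm)
  have hinjOn : Set.InjOn φ (Finset.range n : Set ℕ) := by
    intro m₁ hm₁ m₂ hm₂ heq
    rw [Finset.coe_range, Set.mem_Iio] at hm₁ hm₂
    simp only [φ, Prod.mk.injEq] at heq
    refine hinj m₁ hm₁ m₂ hm₂ (List.ext_getElem heq.1 fun i h₁ h₂ => ?_)
    have hiB : i < B := lt_of_lt_of_le h₁ (hlen m₁ hm₁)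
    have h1 := congrFun heq.2 ⟨i, hiB⟩
    simp only at h1
    rw [List.getD_eq_getElem?_getD, List.getD_eq_getElem?_getD, List.getElem?_eq_getElem h₁,
      List.getElem?_eq_getElem h₂] at h1
    simpa using h1
  have := Finset.card_le_card_of_injOn φ hmaps hinjOn
  simpa [Finset.card_range, Finset.card_univ, Fintype.card_fun, Fintype.card_bool,
    Fintype.card_fin] using this

/-- `(B + 1) · 2^B ≤ 2^{2B+1}`. [folklore] -/
theorem succ_mul_two_pow_le (B : ℕ) : (B + 1) * 2 ^ B ≤ 2 ^ (2 * B + 1) := by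
  rw [show 2 * B + 1 = (B + 1) + B by ring, pow_add]
  exact Nat.mul_le_mul_right _ (Nat.lt_two_pow_self).le

/-! ### Injectivity of the codes -/

/-- `boolPair` is injective in its second argument. [folklore] -/
theorem boolPair_right_inj {a b₁ b₂ : List Bool} (h : boolPair a b₁ = boolPair a b₂) : b₁ = b₂ := by
  have := boolPair_injective (a₁ := (a, b₁)) (a₂ := (a, b₂)) h
  exact (Prod.mk.inj this).2

/-- `boolPair` is injective (curried form). [folklore] -/
theorem boolPair_inj {a₁ a₂ b₁ b₂ : List Bool} (h : boolPair a₁ b₁ = boolPair a₂ b₂) : a₁ = a₂ ∧ b₁ = b₂ :=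
  Prod.mk.inj (boolPair_injective (a₁ := (a₁, b₁)) (a₂ := (a₂, b₂)) h)

/-- A pair code is never empty (private twin of `QCircuit.boolPair_ne_nil` of
`Cryptography/QuantumCircuit.lean`, which is not importable here). [folklore] -/
private theorem boolPair_ne_nil (a b : List Bool) : boolPair a b ≠ [] := by
  simp [boolPair]

/-- The list code is injective (private twin of `ModExpBlock.encList_injective` of
`Cryptography/ShorModExpBlock.lean`, which is not importable here). [folklore] -/
private theorem encList_injective : Function.Injective encList := by
  intro l₁
  induction l₁ with
  | nil =>
    intro l₂ h
    cases l₂ with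
    | nil => rfl
    | cons a l => exact absurd h.symm (by rw [encList_cons]; exact boolPair_ne_nil _ _)
  | cons a l ih =>
    intro l₂ h
    cases l₂ with
    | nil => exact absurd h (by rw [encList_cons]; exact boolPair_ne_nil _ _)
    | cons b l' =>
      rw [encList_cons, encList_cons] at h
      obtain ⟨rfl, h2⟩ := boolPair_inj h
      rw [ih h2]

/-- `bin = encodeNat` is injective. [folklore] -/
theorem bin_injective : Function.Injective bin := fun m n h => by
  have := congrArg bitsToNat h
  simpa using this

/-- The stack code is injective. [folklore] -/
theorem encStack_injective : Function.Injective encStack := fun _ _ h =>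
  List.map_injective_iff.2 bin_injective (encList_injective h)

/-- The stacks code is injective. [folklore] -/
theorem encStacks_injective : Function.Injective encStacks := fun _ _ h =>
  List.map_injective_iff.2 encStack_injective (encList_injective h)

/-- **The code of a configuration (for a fixed program) is injective.** [folklore] -/
theorem enc_injective (P : Prog) : Function.Injective (UnivStep.enc P) := by
  rintro ⟨pc₁, S₁⟩ ⟨pc₂, S₂⟩ h
  obtain ⟨h1, h2⟩ := boolPair_inj (boolPair_right_inj h)
  simp only at h1 h2
  rw [bin_injective h1, encStacks_injective h2]

/-! ### The length of a code -/

/-- `|bin n| ≤ |bin N|` for `n ≤ N`. [folklore] -/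
theorem length_bin_mono {n N : ℕ} (h : n ≤ N) : (bin n).length ≤ (bin N).length := by
  rw [bin, bin, TM2Pass.length_encodeNat_eq_size, TM2Pass.length_encodeNat_eq_size]
  exact Nat.size_le_size h

/-- The code of a stack with symbols `≤ N` has length `≤ (2|bin N| + 2) · |s|`. [folklore] -/
theorem length_encStack_le {N : ℕ} (s : List ℕ) (hs : ∀ a ∈ s, a ≤ N) :
    (encStack s).length ≤ (2 * (bin N).length + 2) * s.length := by
  induction s with
  | nil => simp [encStack]
  | cons a s ih =>
    rw [encStack_cons, length_boolPair, List.length_cons, Nat.mul_succ]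
    have h1 := length_bin_mono (hs a (by simp))
    have h2 := ih (fun b hb => hs b (by simp [hb]))
    omega

/-- The code of stacks with symbols `≤ N` has length `≤ 2 (2|bin N| + 2) · #symbols + 2 · #stacks`.
[folklore] -/
theorem length_encStacks_le {N : ℕ} (S : List (List ℕ)) (hS : ∀ s ∈ S, ∀ a ∈ s, a ≤ N) :
    (encStacks S).length ≤ 2 * (2 * (bin N).length + 2) * stkTotal S + 2 * S.length := by
  induction S with
  | nil => simp [encStacks]
  | cons s S ih =>
    have e : encStacks (s :: S) = boolPair (encStack s) (encStacks S) := rfl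
    rw [e, length_boolPair, List.length_cons, show stkTotal (s :: S) = s.length + stkTotal S by
      simp [stkTotal]]
    have h1 := length_encStack_le s (hS s (by simp))
    have h2 := ih (fun s' hs' => hS s' (by simp [hs']))
    nlinarith

/-- **The length of a code** `⟨P, ⟨pc, stacks⟩⟩` with `pc ≤ H`, symbols `≤ N`: linear in the
number of stack symbols. [folklore] -/
theorem length_enc_le (P : Prog) {N H : ℕ} (pc : ℕ) (S : List (List ℕ)) (hpc : pc ≤ H)
    (hS : ∀ s ∈ S, ∀ a ∈ s, a ≤ N) :
    (UnivStep.enc P (pc, S)).length ≤ 2 * (2 * (bin N).length + 2) * stkTotal S +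
      (2 * (encProg P).length + 2 * (bin H).length + 2 * S.length + 4) := by
  rw [UnivStep.enc, encCfg, length_boolPair, length_boolPair]
  have h1 := length_bin_mono hpc
  have h2 := length_encStacks_le S hS
  simp only at h1 h2 ⊢
  omega

/-! ### Symbols stay below `N` -/

/-- `Instr.SymLe N i`: a `push` pushes a symbol `≤ N`. [folklore] -/
def _root_.Literature.Computability.Complexity.FlatProg.Instr.SymLe (N : ℕ) : Instr → Prop
  | .push _ a _ => a ≤ N
  | _ => True

/-- Every instruction of a compiled program pushes symbols `≤ N`. [folklore] -/
theorem symLe_of_mem_compile (c : TM2Std.SCode) {i : Instr} (h : i ∈ compile c) : i.SymLe c.N := by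
  simp only [compile, List.mem_flatten, List.mem_ofFn] at h
  obtain ⟨l, ⟨lab, rfl⟩, hi⟩ := h
  revert hi
  suffices H : ∀ (q : TM2Std.SStmt c.nK c.N c.nΛ c.nσ) (base : ℕ),
      i ∈ code (FlatProg.entry c) (haltAddr c) q base → i.SymLe c.N from H _ _
  intro q
  induction q with
  | push k f q ih =>
    intro base hi
    rw [code, List.mem_append] at hi
    rcases hi with hi | hi
    · simp only [blocks₁, List.mem_flatten, List.mem_ofFn] at hi
      obtain ⟨l, ⟨s, rfl⟩, hi⟩ := hi
      rw [List.mem_singleton] at hi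
      subst hi
      exact Nat.le_of_lt_succ (f s).isLt
    · exact ih _ hi
  | peek k f q ih =>
    intro base hi
    rw [code, List.mem_append] at hi
    rcases hi with hi | hi
    · simp only [blocksP, List.mem_flatten, List.mem_ofFn] at hi
      obtain ⟨l, ⟨s, rfl⟩, hi⟩ := hi
      rw [List.mem_cons, List.mem_ofFn] at hi
      rcases hi with rfl | ⟨a, rfl⟩
      · trivial
      · exact Nat.le_of_lt_succ a.isLt
    · exact ih _ hi
  | pop k f q ih =>
    intro base hi
    rw [code, List.mem_append] at hi
    rcases hi with hi | hi
    · simp only [blocks₁, List.mem_flatten, List.mem_ofFn] at hi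
      obtain ⟨l, ⟨s, rfl⟩, hi⟩ := hi
      rw [List.mem_singleton] at hi
      subst hi
      trivial
    · exact ih _ hi
  | load f q ih =>
    intro base hi
    rw [code, List.mem_append] at hi
    rcases hi with hi | hi
    · simp only [blocks₁, List.mem_flatten, List.mem_ofFn] at hi
      obtain ⟨l, ⟨s, rfl⟩, hi⟩ := hi
      rw [List.mem_singleton] at hi
      subst hi
      trivial
    · exact ih _ hi
  | branch p q₁ q₂ ih₁ ih₂ =>
    intro base hi
    rw [code, List.mem_append, List.mem_append] at hi
    rcases hi with hi | hi | hi
    · simp only [blocks₁, List.mem_flatten, List.mem_ofFn] at hi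
      obtain ⟨l, ⟨s, rfl⟩, hi⟩ := hi
      rw [List.mem_singleton] at hi
      subst hi
      trivial
    · exact ih₁ _ hi
    · exact ih₂ _ hi
  | goto f =>
    intro base hi
    rw [code, List.mem_ofFn] at hi
    obtain ⟨s, rfl⟩ := hi
    trivial
  | halt =>
    intro base hi
    rw [code, List.mem_ofFn] at hi
    obtain ⟨s, rfl⟩ := hi
    trivial

/-- `SymOK N S`: all symbols on all stacks are `≤ N`. [folklore] -/
def SymOK (N : ℕ) (S : List (List ℕ)) : Prop := ∀ s ∈ S, ∀ a ∈ s, a ≤ N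

/-- One step of a compiled program keeps the symbols `≤ N`. [folklore] -/
theorem symOK_step (c : TM2Std.SCode) {cfg : Cfg} (h : SymOK c.N cfg.2) : SymOK c.N (step (compile c) cfg).2 := by
  unfold step
  cases hP : (compile c)[cfg.1]? with
  | none => exact h
  | some i =>
    have hi := symLe_of_mem_compile c (List.mem_of_getElem? hP)
    cases i with
    | goto j => exact h
    | push k a j =>
      intro s hs b hb
      simp only [Instr.apply] at hs
      -- `s` is a stack of `cfg.2.modify k (a :: ·)`
      obtain ⟨n, hn⟩ := List.getElem_of_mem hs
      obtain ⟨hlt, hsn⟩ := hn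
      rw [List.length_modify] at hlt
      have hget : (cfg.2.modify k fun l => a :: l)[n] = if k = n then a :: cfg.2[n] else cfg.2[n] := by
        simp [List.getElem_modify]
      rw [hget] at hsn
      split_ifs at hsn with hkn
      · subst hsn
        rcases List.mem_cons.1 hb with rfl | hb
        · exact hi
        · exact h _ (List.getElem_mem hlt) b hb
      · subst hsn
        exact h _ (List.getElem_mem hlt) b hb
    | pop k t =>
      intro s hs b hb
      simp only [Instr.apply] at hs
      by_cases hk : k < cfg.2.length
      · rw [List.mem_iff_getElem] at hs
        obtain ⟨n, hn, rfl⟩ := hs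
        rw [List.length_set] at hn
        rw [List.getElem_set] at hb
        split_ifs at hb with hkn
        · subst hkn
          rw [List.getD_eq_getElem?_getD, List.getElem?_eq_getElem hk, Option.getD_some] at hb
          exact h _ (List.getElem_mem hk) b (List.mem_of_mem_tail hb)
        · exact h _ (List.getElem_mem hn) b hb
      · rw [List.set_eq_of_length_le (not_lt.1 hk)] at hs
        exact h s hs b hb

/-- Iterated steps of a compiled program keep the symbols `≤ N`. [folklore] -/
theorem symOK_iterate (c : TM2Std.SCode) {cfg : Cfg} (h : SymOK c.N cfg.2) (n : ℕ) :
    SymOK c.N ((step (compile c))^[n] cfg).2 := by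
  induction n with
  | zero => exact h
  | succ n ih => rw [iterate_succ_apply']; exact symOK_step c ih

/-- Coded stack assignments have symbols `≤ N`. [folklore] -/
theorem symOK_encStk {nK N : ℕ} (S : Fin nK → List (Fin (N + 1))) : SymOK N (UnivTM2.encStk S) := by
  intro s hs a ha
  rw [UnivTM2.encStk, List.mem_ofFn] at hs
  obtain ⟨k, rfl⟩ := hs
  rw [List.mem_map] at ha
  obtain ⟨b, -, rfl⟩ := ha
  exact Nat.le_of_lt_succ b.isLt

/-! ### Between two machine steps -/

section Boundary

variable (c : TM2Std.SCode)

/-- **Every flat configuration of a compiled run sits at most `haltAddr` flat steps after the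
code of a machine configuration**, with its program counter at most `haltAddr`.
[cite: AroraBarakCC2009, §1.4 (machines as strings)] -/
theorem exists_boundary (a : c.tm.Cfg) (m : ℕ) :
    ∃ (t : ℕ) (b : c.tm.Cfg) (j : ℕ), (flip bind c.tm.step)^[t] (some a) = some b ∧ j ≤ haltAddr c ∧
      (step (compile c))^[m] (trCfg c a) = (step (compile c))^[j] (trCfg c b) ∧
        ((step (compile c))^[m] (trCfg c a)).1 ≤ haltAddr c := by
  -- the invariant: halted at `b`, or strictly inside the simulation of the step from `b`
  have inv : ∀ m, ∃ (t : ℕ) (b : c.tm.Cfg), (flip bind c.tm.step)^[t] (some a) = some b ∧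
      ((c.tm.step b = none ∧ (step (compile c))^[m] (trCfg c a) = trCfg c b) ∨
        ∃ (n j : ℕ) (b' : c.tm.Cfg), j < n ∧ n ≤ haltAddr c ∧ c.tm.step b = some b' ∧
          (step (compile c))^[n] (trCfg c b) = trCfg c b' ∧
          (∀ m' < n, ((step (compile c))^[m'] (trCfg c b)).1 < (compile c).length) ∧
          (step (compile c))^[m] (trCfg c a) = (step (compile c))^[j] (trCfg c b)) := by
    -- entering the step from a configuration `b` reached at time `t`
    have enter : ∀ (m t : ℕ) (b : c.tm.Cfg), (flip bind c.tm.step)^[t] (some a) = some b →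
        (step (compile c))^[m] (trCfg c a) = trCfg c b →
        ∃ (t : ℕ) (b : c.tm.Cfg), (flip bind c.tm.step)^[t] (some a) = some b ∧
          ((c.tm.step b = none ∧ (step (compile c))^[m] (trCfg c a) = trCfg c b) ∨
            ∃ (n j : ℕ) (b' : c.tm.Cfg), j < n ∧ n ≤ haltAddr c ∧ c.tm.step b = some b' ∧
              (step (compile c))^[n] (trCfg c b) = trCfg c b' ∧
              (∀ m' < n, ((step (compile c))^[m'] (trCfg c b)).1 < (compile c).length) ∧
              (step (compile c))^[m] (trCfg c a) = (step (compile c))^[j] (trCfg c b)) := by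
      intro m t b ht hm
      cases hb : c.tm.step b with
      | none => exact ⟨t, b, ht, Or.inl ⟨hb, hm⟩⟩
      | some b' =>
        obtain ⟨n, hn, hnH, e, p⟩ := runsB_step c hb
        exact ⟨t, b, ht, Or.inr ⟨n, 0, b', hn, hnH, hb, e, p, hm⟩⟩
    intro m
    induction m with
    | zero => exact enter 0 0 a rfl rfl
    | succ m ih =>
      obtain ⟨t, b, ht, hcase⟩ := ih
      rcases hcase with ⟨hb, hm⟩ | ⟨n, j, b', hjn, hnH, hb, e, p, hm⟩
      · refine ⟨t, b, ht, Or.inl ⟨hb, ?_⟩⟩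
        rw [iterate_succ_apply', hm, step_trCfg_of_none c hb]
      · by_cases hj : j + 1 < n
        · exact ⟨t, b, ht, Or.inr ⟨n, j + 1, b', hj, hnH, hb, e, p, by
            rw [iterate_succ_apply', hm, ← iterate_succ_apply' (step (compile c)) j]⟩⟩
        · have hj' : j + 1 = n := by omega
          refine enter (m + 1) (t + 1) b' ?_ ?_
          · rw [iterate_succ_apply', ht]
            exact hb
          · rw [iterate_succ_apply', hm, ← iterate_succ_apply' (step (compile c)) j]
            show (step (compile c))^[j + 1] (trCfg c b) = trCfg c b'
            rw [hj', e]
  obtain ⟨t, b, ht, hcase⟩ := inv m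
  rcases hcase with ⟨hb, hm⟩ | ⟨n, j, b', hjn, hnH, hb, e, p, hm⟩
  · refine ⟨t, b, 0, ht, Nat.zero_le _, hm, ?_⟩
    rw [hm, trCfg_fst_of_none c ((step_eq_none_iff c b).1 hb)]
  · refine ⟨t, b, j, ht, by omega, hm, ?_⟩
    rw [hm, ← length_compile]
    exact (p j hjn).le

end Boundary

/-! ### A transducer emitting a block per bit -/

/-- The one-state transducer emitting the block `β b` for every input bit `b`. [folklore] -/
def blocksT (β : Bool → List Bool) : FST Unit Bool Bool where
  init := ()
  step := fun _ b => ((), β b)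
  front := fun _ => []
  keep := fun _ => true

/-- `blocksT β` computes `x ↦ x.flatMap β`. [folklore] -/
theorem blocksT_eval (β : Bool → List Bool) (x : List Bool) : (blocksT β).eval x = x.flatMap β := by
  have h : ∀ x : List Bool, ((blocksT β).run () x).2 = x.flatMap β := by
    intro x
    induction x with
    | nil => rfl
    | cons b x ih =>
      rw [FST.run_cons, List.flatMap_cons]
      show β b ++ ((blocksT β).run () x).2 = _
      rw [ih]
  show (blocksT β).front ((blocksT β).run () x).1 ++
    (if (blocksT β).keep ((blocksT β).run () x).1 then ((blocksT β).run () x).2 else []) = _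
  rw [h]
  rfl

/-- `x ↦ x.flatMap β ∈ FP`. [cite: AroraBarakCC2009, §1.3] -/
theorem flatMap_mem_FP (β : Bool → List Bool) : (fun x : List Bool => x.flatMap β) ∈ FP := by
  have h : (fun x : List Bool => x.flatMap β) = (blocksT β).eval := funext fun x => (blocksT_eval β x).symm
  rw [h]
  exact (blocksT β).polyTimeComputable_eval

/-- The coded input stack is a bitwise block map: `encStack (x.map cb) = x.flatMap …`. [folklore] -/
theorem encStack_map_eq_flatMap (cb : Bool → ℕ) (x : List Bool) :
    encStack (x.map cb) = x.flatMap fun b => ((bin (cb b)).flatMap fun d => [d, d]) ++ [false, true] := by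
  rw [encStack, List.map_map, Com.encList_eq_flatMap, List.flatMap_map]
  rfl

/-! ### The machine, its standard machine and its flat program -/

section Machine

variable (M : SpaceMachine Bool Bool)

/-- The standard machine of the space machine. [folklore] -/
abbrev sc : TM2Std.SCode := TM2Std.stdCode M.tm

/-- Its flat program. [folklore] -/
abbrev prog : Prog := compile (sc M)

/-- A `FinTM2` halts exactly at label `none`. [Mathlib `Turing.TM2.step`] [folklore] -/
theorem finTM2_step_eq_none_iff (T : FinTM2) (a : T.Cfg) : T.step a = none ↔ a.l = none := by
  obtain ⟨_ | l, v, S⟩ := a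
  · exact ⟨fun _ => rfl, fun _ => rfl⟩
  · exact ⟨fun h => (by cases h), fun h => (by cases h)⟩

/-- A halted configuration is coded by a halted standard configuration. [folklore] -/
theorem std_step_none {a : M.tm.Cfg} (h : M.tm.step a = none) :
    (sc M).tm.step (TM2Std.trCfg M.tm a) = none := by
  rw [FlatProg.step_eq_none_iff]
  show a.l.map (TM2Std.eΛ M.tm) = none
  rw [(finTM2_step_eq_none_iff M.tm a).1 h]
  rfl

/-- **The standard machine mirrors the machine**: `t` steps from the code of `a` are the code of
`t` steps from `a` (and reached configurations have allowed symbols only).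
[cite: AroraBarakCC2009, §1.4 (machines as strings)] -/
theorem std_iterate (t : ℕ) : ∀ a : M.tm.Cfg, TM2Std.StkOK M.tm a.stk →
    (flip bind (sc M).tm.step)^[t] (some (TM2Std.trCfg M.tm a)) =
      ((flip bind M.tm.step)^[t] (some a)).map (TM2Std.trCfg M.tm) ∧
    ∀ b, (flip bind M.tm.step)^[t] (some a) = some b → TM2Std.StkOK M.tm b.stk := by
  induction t with
  | zero =>
    intro a ha
    refine ⟨rfl, fun b hb => ?_⟩
    simp only [iterate_zero, id_eq, Option.some.injEq] at hb
    exact hb ▸ ha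
  | succ t ih =>
    intro a ha
    rw [TM2Comp.iterate_bind_succ, TM2Comp.iterate_bind_succ]
    cases hst : M.tm.step a with
    | none =>
      rw [std_step_none M hst, TM2Comp.iterate_bind_none, TM2Comp.iterate_bind_none]
      exact ⟨rfl, fun b hb => by cases hb⟩
    | some a' =>
      obtain ⟨h1, h2⟩ := TM2Std.step_tr M.tm a a' ha hst
      rw [h1]
      exact ih a' h2

/-- The total number of stack symbols of a machine configuration is that of its flat code.
[folklore] -/
theorem stkTotal_trCfg (b : M.tm.Cfg) :
    letI := M.tm.kFin
    stkTotal (FlatProg.trCfg (sc M) (TM2Std.trCfg M.tm b)).2 = ∑ k, (b.stk k).length := by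
  letI := M.tm.kFin
  rw [trCfg_snd]
  show stkTotal (UnivTM2.encStk (TM2Std.trStk M.tm b.stk)) = _
  rw [stkTotal, UnivTM2.encStk, List.map_ofFn, List.sum_ofFn]
  have h : ∀ k' : Fin (TM2Std.nK M.tm), (List.length ∘ fun k => List.map Fin.val (TM2Std.trStk M.tm b.stk k)) k' =
      (b.stk ((TM2Std.eK M.tm).symm k')).length := by
    intro k'
    show (List.map Fin.val (TM2Std.trStk M.tm b.stk k')).length = _
    unfold TM2Std.trStk TM2Std.stkCode
    rw [List.length_map, List.length_map]
  rw [Fintype.sum_congr _ _ h]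
  exact Equiv.sum_comp (TM2Std.eK M.tm).symm (fun k => (b.stk k).length)

/-- **Input preservation and the space bound bound the total number of stack symbols** of a
reachable configuration by `|x| + space`. [cite: AroraBarakCC2009, Def. 4.1 (read-only input, work space)] -/
theorem sum_stk_le (hIP : M.IsInputPreserving) {x : List Bool} {S : ℕ} (hRS : M.RunsInSpace x S)
    {b : M.tm.Cfg} (hb : StateTransition.Reaches M.tm.step (M.init x) b) :
    letI := M.tm.kFin
    ∑ k, (b.stk k).length ≤ x.length + S := by
  letI := M.tm.kFin
  have hws := hRS b hb
  have hin := congrArg List.length (hIP x b hb)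
  rw [List.length_append, List.length_reverse, List.length_map, List.length_map] at hin
  have hkL : M.kL ∈ Finset.univ.erase M.tm.k₀ := Finset.mem_erase.2 ⟨M.kL_ne_k₀, Finset.mem_univ _⟩
  have e := (Finset.sum_erase_add _ (fun k => (b.stk k).length) hkL)
  have e' := Finset.sum_erase_add _ (fun k => (b.stk k).length) (Finset.mem_univ M.tm.k₀)
  unfold SpaceMachine.workSpace at hws
  omega

/-! ### The size of the flat run -/

/-- The coefficient of the budget: twice the cost of one stack symbol. [folklore] -/
def kap1 : ℕ := 2 * (2 * (bin (sc M).N).length + 2)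

/-- The constant of the budget: program, program counter, stack separators. [folklore] -/
def kap0 : ℕ := 2 * (encProg (prog M)).length + 2 * (bin (haltAddr (sc M))).length + 2 * (sc M).nK + 4

/-- **The budget** for inputs of length `n` and work space `s`: linear in `n + s`. [folklore] -/
def bud (n s : ℕ) : ℕ := kap1 M * (n + s + haltAddr (sc M)) + kap0 M

/-- The flat code of the initial configuration on `x`. [folklore] -/
def f₀ (x : List Bool) : Cfg := FlatProg.trCfg (sc M) (TM2Std.trCfg M.tm (M.init x))

/-- **Every code met along the flat run of the machine on `x` fits the budget.**
[cite: AroraBarakCC2009, §4.2 eq. (4.3) ("in space n")] -/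
theorem length_enc_iterate_le (hIP : M.IsInputPreserving) {x : List Bool} {S : ℕ} (hRS : M.RunsInSpace x S)
    (m : ℕ) : (UnivStep.enc (prog M) ((step (prog M))^[m] (f₀ M x))).length ≤ bud M x.length S := by
  letI := M.tm.kFin
  obtain ⟨t, b, j, ht, hjH, hm, hpc⟩ := exists_boundary (sc M) (TM2Std.trCfg M.tm (M.init x)) m
  -- `b` is the code of a reachable machine configuration `bT`
  obtain ⟨hmir, hok⟩ := std_iterate M t (M.init x) (TM2Std.stkOK_initList M.tm _)
  rw [hmir] at ht
  cases hT : (flip bind M.tm.step)^[t] (some (M.init x)) with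
  | none => rw [hT] at ht; cases ht
  | some bT =>
    rw [hT, Option.map_some, Option.some.injEq] at ht
    subst ht
    have hreach : StateTransition.Reaches M.tm.step (M.init x) bT :=
      StateTransition.reaches_of_iterate_flip_bind _ t _ _ hT
    change (step (prog M))^[m] (f₀ M x) = _ at hm
    change ((step (prog M))^[m] (f₀ M x)).1 ≤ _ at hpc
    -- the bound on symbols
    have htot : stkTotal ((step (prog M))^[m] (f₀ M x)).2 ≤ x.length + S + haltAddr (sc M) := by
      rw [hm]
      have h1 := stkTotal_iterate_le (compile (sc M)) (FlatProg.trCfg (sc M) (TM2Std.trCfg M.tm bT)) j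
      have h2 := stkTotal_trCfg M bT
      have h3 := sum_stk_le M hIP hRS hreach
      rw [← h2] at h3
      omega
    have hsym : SymOK (sc M).N ((step (prog M))^[m] (f₀ M x)).2 := by
      rw [hm]
      exact symOK_iterate _ (by rw [trCfg_snd]; exact symOK_encStk _) j
    have hlenS : ((step (prog M))^[m] (f₀ M x)).2.length = (sc M).nK :=
      length_snd_iterate_step (sc M) m _ (by rw [f₀, trCfg_snd, length_encStk])
    rcases hcf : (step (prog M))^[m] (f₀ M x) with ⟨pc, SS⟩
    rw [hcf] at hpc htot hsym hlenS
    have h := length_enc_le (prog M) (N := (sc M).N) (H := haltAddr (sc M)) pc SS hpc hsym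
    rw [hlenS] at h
    have h' := Nat.mul_le_mul_left (2 * (2 * (bin (sc M).N).length + 2)) htot
    rw [bud, kap1, kap0]
    simp only at h h' ⊢
    omega

/-! ### The reduction -/

/-- The code of an input bit as an input-stack symbol number. [folklore] -/
def cb (b : Bool) : ℕ := (TM2Std.enc M.tm ⟨M.tm.k₀, M.inputAlphabet.symm b⟩).val

/-- The (binary) index of the output stack. [folklore] -/
def k1c : List Bool := bin (TM2Std.eK M.tm M.tm.k₁).val

/-- The code of the output stack holding the symbol `true`. [folklore] -/
def accc : List Bool := encStack [(TM2Std.enc M.tm ⟨M.tm.k₁, M.outputAlphabet.symm true⟩).val]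

/-- The budget polynomial for space `c nʲ + c`. [folklore] -/
def pu (c j : ℕ) : Polynomial ℕ :=
  C (kap1 M) * (X + (C c * X ^ j + C c) + C (haltAddr (sc M))) + C (kap0 M)

/-- The budget polynomial evaluates to the budget. [folklore] -/
theorem eval_pu (c j n : ℕ) : (pu M c j).eval n = bud M n (c * n ^ j + c) := by
  simp [pu, bud]

/-- **The instance of `x`**: `⟨P, ⟨cfg₀(x), ⟨1^{bud}, ⟨k₁, acc⟩⟩⟩⟩`.
[cite: AroraBarakCC2009, §4.2 eq. (4.3) (the instance ⟨M, w, 1ⁿ⟩)] -/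
def red (c j : ℕ) (x : List Bool) : List Bool :=
  boolPair (encProg (prog M)) (boolPair (encCfg (f₀ M x))
    (boolPair (ones ((pu M c j).eval x.length)) (boolPair (k1c M) (accc M))))

/-- The flat code of the initial configuration, explicitly: entry of `main`, all stacks empty but
the input stack, which holds the coded input. [folklore] -/
theorem f₀_eq (x : List Bool) : f₀ M x =
    (FlatProg.entry (sc M) (sc M).main (sc M).init,
      (List.replicate (sc M).nK []).set (sc M).k₀.val (x.map (cb M))) := by
  rw [f₀, SpaceMachine.init, TM2Std.trCfg_initList, TM2Comp.initList_eq]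
  show (FlatProg.entry (sc M) (sc M).main (sc M).init, UnivTM2.encStk _) = _
  congr 1
  rw [UnivTM2.encStk_update]
  congr 1
  · rw [UnivTM2.encStk]
    simp
  · rw [TM2Std.stkCode, List.map_map, List.map_map]
    rfl

/-- The configuration field as an `FP` string function. [folklore] -/
def cfgFn : List Bool → List Bool :=
  fanoutFn (fun _ => bin (FlatProg.entry (sc M) (sc M).main (sc M).init))
    (setNthLF ∘ fanoutFn (fun _ => ones (sc M).nK) (fanoutFn (fun _ => bin (sc M).k₀.val)
      (fanoutFn (fun x => x.flatMap fun b => ((bin (cb M b)).flatMap fun d => [d, d]) ++ [false, true])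
        (fun _ => encList ((List.replicate (sc M).nK []).map encStack)))))

/-- `cfgFn` computes the code of the initial configuration. [folklore] -/
theorem cfgFn_apply (x : List Bool) : cfgFn M x = encCfg (f₀ M x) := by
  have hs : (setNthLF ∘ fanoutFn (fun _ => ones (sc M).nK) (fanoutFn (fun _ => bin (sc M).k₀.val)
      (fanoutFn (fun x => x.flatMap fun b => ((bin (cb M b)).flatMap fun d => [d, d]) ++ [false, true])
        (fun _ => encList ((List.replicate (sc M).nK []).map encStack))))) x =
      encStacks ((List.replicate (sc M).nK []).set (sc M).k₀.val (x.map (cb M))) := by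
    rw [Function.comp_apply, fanoutFn_apply, fanoutFn_apply, fanoutFn_apply, ← encStack_map_eq_flatMap,
      setNthLF_apply _ (by rw [ones, List.length_replicate]; exact (sc M).k₀.isLt) _
        (by rw [List.length_map, List.length_replicate]; exact (sc M).k₀.isLt),
      encStacks, List.map_set]
  rw [cfgFn, fanoutFn_apply, hs, f₀_eq]
  rfl

/-- `cfgFn ∈ FP`. [cite: AroraBarakCC2009, §1.3] -/
theorem cfgFn_mem_FP : cfgFn M ∈ FP :=
  fanoutFn_mem_FP (const_mem_FP _) (comp_mem_FP setNthLF_mem_FP (fanoutFn_mem_FP (const_mem_FP _)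
    (fanoutFn_mem_FP (const_mem_FP _) (fanoutFn_mem_FP (flatMap_mem_FP _) (const_mem_FP _)))))

/-- The reduction as an `FP` string function. [folklore] -/
def redFn (c j : ℕ) : List Bool → List Bool :=
  fanoutFn (fun _ => encProg (prog M)) (fanoutFn (cfgFn M)
    (fanoutFn (Plumb.polyFn (pu M c j)) (fanoutFn (fun _ => k1c M) (fun _ => accc M))))

/-- `redFn` computes `red`. [folklore] -/
theorem redFn_apply (c j : ℕ) (x : List Bool) : redFn M c j x = red M c j x := by
  simp only [redFn, red, fanoutFn_apply, cfgFn_apply, Plumb.polyFn_apply]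

/-- **The reduction is polynomial-time.** [cite: AroraBarakCC2009, §4.2 (Exercise 4.2)] -/
theorem redFn_mem_FP (c j : ℕ) : redFn M c j ∈ FP :=
  fanoutFn_mem_FP (const_mem_FP _) (fanoutFn_mem_FP (cfgFn_mem_FP M)
    (fanoutFn_mem_FP (Plumb.polyFn_mem_FP _) (fanoutFn_mem_FP (const_mem_FP _) (const_mem_FP _))))

/-! ### Correctness of the reduction -/

/-- Codes of allowed symbols are injective. [folklore] -/
theorem enc_eq_enc_iff_of_allowed {T : FinTM2} {y z : Σ k, T.Γ k} (hy : y ∈ TM2Std.allowed T) :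
    TM2Std.enc T y = TM2Std.enc T z ↔ y = z := by
  refine ⟨fun h => ?_, fun h => by rw [h]⟩
  have d := TM2Std.dec_enc T hy
  rw [h] at d
  by_cases hz : z ∈ TM2Std.allowed T
  · rw [TM2Std.dec_enc T hz, Option.some.injEq] at d
    exact d.symm
  · unfold TM2Std.enc at d
    rw [dif_neg hz] at d
    unfold TM2Std.dec at d
    rw [dif_pos rfl] at d
    cases d

/-- A list whose image is a singleton is a singleton. [folklore] -/
theorem eq_singleton_of_map_eq {α β : Type} (e : α ≃ β) {l : List α} {b : β} (h : l.map e = [b]) :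
    l = [e.symm b] := by
  rcases l with _ | ⟨a, _ | ⟨a', l⟩⟩
  · cases h
  · simp only [List.map_cons, List.map_nil, List.cons.injEq, and_true] at h
    rw [← h, Equiv.symm_apply_apply]
  · simp at h

/-- **The answer bit of the halting code**: for the halting configuration `cfin` of the machine
(with allowed symbols) whose output stack reads `[b]`, the flat code is accepted iff `b = true`.
[cite: AroraBarakCC2009, §4.2 eq. (4.3) ("M accepts w")] -/
theorem accBit_trCfg_iff {cfin : M.tm.Cfg} (hok : TM2Std.StkOK M.tm cfin.stk) (hl : cfin.l = none)
    {b : Bool} (hout : (cfin.stk M.tm.k₁).map M.outputAlphabet = [b]) :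
    accBit (k1c M) (accc M)
      (UnivStep.enc (prog M) (FlatProg.trCfg (sc M) (TM2Std.trCfg M.tm cfin))) = true ↔ b = true := by
  -- the halting flat configuration
  have hcfg : FlatProg.trCfg (sc M) (TM2Std.trCfg M.tm cfin) =
      (haltAddr (sc M), UnivTM2.encStk (TM2Std.trStk M.tm cfin.stk)) := by
    rw [FlatProg.trCfg, FlatProg.fin]
    show ((cfin.l.map (TM2Std.eΛ M.tm)).elim (haltAddr (sc M)) _, _) = _
    rw [hl]
    rfl
  have hγ := eq_singleton_of_map_eq M.outputAlphabet hout
  -- halted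
  have hhalt : insF (UnivStep.enc (prog M) (haltAddr (sc M), UnivTM2.encStk (TM2Std.trStk M.tm cfin.stk))) = [] :=
    insF_enc_of_none (List.getElem?_eq_none (length_compile (sc M)).le)
  -- the output stack
  have hout' : outOf (k1c M) (UnivStep.enc (prog M) (haltAddr (sc M), UnivTM2.encStk (TM2Std.trStk M.tm cfin.stk))) =
      encStack [(TM2Std.enc M.tm ⟨M.tm.k₁, M.outputAlphabet.symm b⟩).val] := by
    obtain ⟨-, -, h3⟩ := fields_enc (prog M) (haltAddr (sc M)) (UnivTM2.encStk (TM2Std.trStk M.tm cfin.stk))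
    rw [outOf, h3, k1c, encStacks, nthLF_self, getD_map_nil encStack [] rfl, UnivTM2.encStk_getD,
      TM2Std.trStk_apply, TM2Std.stkCode, hγ]
    rfl
  rw [hcfg, accBit, hhalt, hout', accc]
  simp only [decide_true, Bool.true_and, decide_eq_true_eq]
  rw [(encStack_injective).eq_iff, List.cons.injEq, and_iff_left rfl, Fin.val_inj]
  have hallowed : (⟨M.tm.k₁, M.outputAlphabet.symm b⟩ : Σ k, M.tm.Γ k) ∈ TM2Std.allowed M.tm :=
    hok M.tm.k₁ _ (by rw [hγ]; exact List.mem_singleton_self _)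
  rw [enc_eq_enc_iff_of_allowed hallowed]
  constructor
  · intro h
    have := eq_of_heq (Sigma.mk.inj h).2
    exact M.outputAlphabet.symm.injective this
  · intro h; rw [h]

/-- **Correctness of the reduction.** If `M` decides `L` in space `c nʲ + c`, then
`x ∈ L ↔ red x ∈ SPACETMSAT`. [cite: AroraBarakCC2009, §4.2 eq. (4.3) and Exercise 4.2] -/
theorem mem_iff_red_mem {L : Language Bool} {c j : ℕ}
    (hD : DecidesInSpace M L fun x => c * x.length ^ j + c) (x : List Bool) :
    x ∈ L ↔ red M c j x ∈ SPACETMSAT := by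
  obtain ⟨hIP, hall⟩ := hD
  obtain ⟨⟨cfin, hfin, hout⟩, hRS⟩ := hall x
  -- the codes along the run fit the budget
  have hsmall : ∀ m, (ustepFn^[m] (boolPair (encProg (prog M)) (encCfg (f₀ M x)))).length ≤
      (ones ((pu M c j).eval x.length)).length := by
    intro m
    rw [ones, List.length_replicate, eval_pu, show boolPair (encProg (prog M)) (encCfg (f₀ M x)) =
      UnivStep.enc (prog M) (f₀ M x) from rfl, f₀, iterate_ustepFn_enc_trCfg, ← f₀]
    exact length_enc_iterate_le M hIP hRS m
  rw [red, mem_SPACETMSAT_iff _ _ _ _ _ hsmall, ones, List.length_replicate,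
    show boolPair (encProg (prog M)) (encCfg (f₀ M x)) = UnivStep.enc (prog M) (f₀ M x) from rfl, f₀,
    iterate_ustepFn_enc_trCfg]
  -- the machine halts in `cfin`; the standard machine and the flat program follow
  obtain ⟨hreach, hnone⟩ := StateTransition.mem_eval.1 hfin
  obtain ⟨n, hn⟩ := SpaceLoop.exists_iterate_of_reaches hreach
  obtain ⟨hmir, hok⟩ := std_iterate M n (M.init x) (TM2Std.stkOK_initList M.tm _)
  rw [hn, Option.map_some] at hmir
  have hokfin := hok cfin hn
  have hstd : TM2Std.trCfg M.tm cfin ∈ StateTransition.eval (sc M).tm.step (TM2Std.trCfg M.tm (M.init x)) :=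
    StateTransition.mem_eval.2 ⟨StateTransition.reaches_of_iterate_flip_bind _ n _ _ hmir, std_step_none M hnone⟩
  obtain ⟨n₀, hn₀⟩ := FlatProg.exists_iterate_eq_of_mem_eval (sc M) hstd
  -- abbreviations
  set P := prog M with hP
  set a₀ := TM2Std.trCfg M.tm (M.init x) with ha₀
  set ffin := FlatProg.trCfg (sc M) (TM2Std.trCfg M.tm cfin) with hffin
  have hH : ffin.1 = haltAddr (sc M) := (hn₀ n₀ le_rfl).2
  -- the first halting time is at most `(B+1) 2^B ≤ 2^{2B+1}`
  have hex : ∃ m, ((step P)^[m] (FlatProg.trCfg (sc M) a₀)).1 = haltAddr (sc M) :=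
    ⟨n₀, by rw [(hn₀ n₀ le_rfl).1]; exact hH⟩
  classical
  have habs : ∀ m, ((step P)^[m] (FlatProg.trCfg (sc M) a₀)).1 = haltAddr (sc M) →
      ((step P)^[m + 1] (FlatProg.trCfg (sc M) a₀)).1 = haltAddr (sc M) := by
    intro m hm
    rw [iterate_succ_apply', step_of_le (by rw [length_compile]; exact hm.ge)]
    exact hm
  have hfind : Nat.find hex ≤ 2 ^ (2 * (pu M c j).eval x.length + 1) := by
    refine le_trans ?_ (succ_mul_two_pow_le _)
    refine card_le_of_injective_short (fun m => UnivStep.enc P ((step P)^[m] (FlatProg.trCfg (sc M) a₀)))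
      (fun m _ => by rw [eval_pu]; exact length_enc_iterate_le M hIP hRS m) fun m₁ hm₁ m₂ hm₂ heq => ?_
    have heq' := enc_injective P heq
    by_contra hne
    rcases Nat.lt_or_gt_of_ne hne with hlt | hlt
    · exact iterate_ne_of_lt_find (step P) (FlatProg.trCfg (sc M) a₀) (fun cfg => cfg.1 = haltAddr (sc M))
        hex habs hlt hm₂.le heq'
    · exact iterate_ne_of_lt_find (step P) (FlatProg.trCfg (sc M) a₀) (fun cfg => cfg.1 = haltAddr (sc M))
        hex habs hlt hm₁.le heq'.symm
  -- from the first halting time on the flat configuration is `ffin`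
  have hfix : ∀ d, (step P)^[Nat.find hex + d] (FlatProg.trCfg (sc M) a₀) =
      (step P)^[Nat.find hex] (FlatProg.trCfg (sc M) a₀) := by
    intro d
    rw [Nat.add_comm, iterate_add_apply]
    exact iterate_step_of_le (by rw [length_compile]; exact (Nat.find_spec hex).ge) d
  have hval : (step P)^[Nat.find hex] (FlatProg.trCfg (sc M) a₀) = ffin := by
    obtain ⟨d, hd⟩ := Nat.exists_eq_add_of_le (Nat.find_min' hex (m := n₀) (by rw [(hn₀ n₀ le_rfl).1]; exact hH))
    rw [← hfix d, ← hd]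
    exact (hn₀ n₀ le_rfl).1
  obtain ⟨d, hd⟩ := Nat.exists_eq_add_of_le (hfind.trans (Nat.le_add_right _ 1))
  rw [hd, hfix d, hval, hffin, accBit_trCfg_iff M hokfin ((finTM2_step_eq_none_iff M.tm cfin).1 hnone) hout]
  exact (Set.mem_iff_boolIndicator L x)

/-- **`L ≤ₚ SPACETMSAT` for every language decided in polynomial space.** [cite: AroraBarakCC2009, §4.2 (Exercise 4.2)] -/
theorem karpReducible_of_decidesInSpace {L : Language Bool} {c j : ℕ}
    (hD : DecidesInSpace M L fun x => c * x.length ^ j + c) : PolyTimeKarpReducible L SPACETMSAT :=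
  ⟨redFn M c j, redFn_mem_FP M c j, fun x => by rw [redFn_apply]; exact mem_iff_red_mem M hD x⟩

end Machine

end SpaceTMSAT

/-! ### `PSPACE`-completeness and the discharge of `F1` -/

/-- **`SPACETMSAT` is `PSPACE`-hard**: every `L ∈ PSPACE` Karp-reduces to it.
[cite: AroraBarakCC2009, §4.2, eq. (4.3) and Exercise 4.2] [cite: HomerSelman2011, §7.5.1 (Homework 7.13)] -/
theorem isHard_PSPACE_SPACETMSAT : IsHard PSPACE SPACETMSAT := by
  intro L hL
  obtain ⟨j, hj⟩ := Set.mem_iUnion.1 hL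
  obtain ⟨c, M, hM⟩ := hj
  exact SpaceTMSAT.karpReducible_of_decidesInSpace M hM

/-- **`SPACETMSAT` is `PSPACE`-complete.** [cite: AroraBarakCC2009, §4.2, eq. (4.3) and Exercise 4.2] [cite: HomerSelman2011, §7.5.1 (Homework 7.13)] -/
theorem isComplete_PSPACE_SPACETMSAT : IsComplete PSPACE SPACETMSAT :=
  ⟨SPACETMSAT_mem_PSPACE, isHard_PSPACE_SPACETMSAT⟩

/-- **Discharge of the named fact `exists_isComplete_PSPACE`** (`SpaceOracles.lean`, F1): there is a
`PSPACE`-complete language, namely `SPACETMSAT`. [cite: HomerSelman2011, §7.5.1 and Thm. 7.17] [cite: AroraBarakCC2009, §4.2 (Def. 4.9, eq. (4.3), Exercise 4.2)] -/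
theorem exists_isComplete_PSPACE_holds : exists_isComplete_PSPACE :=
  ⟨SPACETMSAT, isComplete_PSPACE_SPACETMSAT⟩

end Literature.Computability.Complexity
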